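import Literature.NumberTheory.Automorphic.GLnQuotientSubgroupHaar
import Literature.NumberTheory.Automorphic.AutomorphicQuotientKernel
import Literature.NumberTheory.Automorphic.AutomorphicMeasureGLDomain
import Literature.NumberTheory.Automorphic.SiegelConeDyadic
import Literature.NumberTheory.Automorphic.GodementJacquetZetaIntegrals
import Literature.NumberTheory.Automorphic.GLnAdelicIntegrationFactsProofs
import Literature.NumberTheory.Automorphic.GLnIwasawaIntegration
import HarnessLib

/-!
# The kernel of the global zeta integral on `GL_n`: `∫_H F dρ_H = κ ∫_{A_G} Σ_{γ ∈ GL_n(K)} F(a γ) da`,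
# and `A_G ≅ ℝ`

Topic `NumberTheory/Automorphic`; namespace `Literature.NumberTheory.Automorphic`. The `GL_n`-specific
form of the kernel of `R(F)` on the automorphic quotient `X = GL_n(𝔸_K) ⧸ H`, `H = A_G · GL_n(K)`
(`AutomorphicQuotientKernel`, `AutomorphicKernelL1`), i.e. the second unfolding step of the global
zeta integrals of Godement–Jacquet (LNM 260 (1972), §12: the kernel
`K_Φ(h, g) = ∫_{A_G} Σ_{ξ ∈ GL_n(K)} Φ(h⁻¹ ξ a g) |det|^s da` before Poisson summation), on the
bricks `GLnQuotientSubgroupHaar` (`H ≅ A_G × GL_n(K)`, `ρ_H` versus `dα ⊗ counting`) and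
`GLnAutomorphicUnfolding`:

* `exists_map_quotientSubgroupEquiv_eq_smul_prod` — **`ρ_H = κ · (dα ⊗ counting)`** as an identity
  of measures along `quotientSubgroupEquiv`; `integral_quotientSubgroup_eq_smul_integral_tsum` —
  its Bochner form `∫_H F dρ_H = κ ∫_{A_G} Σ_γ F(a γ) dα(a)` for integrable `F`, with the absolute
  convergence (`γ ↦ F(a γ)` summable in norm for a.e. `a`, `a ↦ Σ_γ F(a γ)` integrable).
* `cosetKernel_quotientSubgroup_eq_smul_integral_tsum` — **the kernel**
  `K_F(x̃, ỹH) = κ ∫_{A_G} Σ_{γ ∈ GL_n(K)} F(x̃ γ a ỹ⁻¹) dα(a)`.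
* `centerLog n K hn : A_G ≃ₜ ℝ`, `a ↦ log |det a|_𝔸` (`n ≥ 1`), with `exp_centerLog`, `centerLog_mul`;
  `exists_map_centerLog_eq_smul_volume` — **the Haar measure of `A_G` is `c · dv` in the coordinate
  `v = log |det a|_𝔸`**, and the substitution lemmas `integral_comp_centerLog_eq_smul`,
  `lintegral_comp_centerLog_eq_mul` (the Mellin variable of Godement–Jacquet, §12–13).
* `isInvInvariant_of_isHaarMeasure_gl` — every Haar measure on `GL_n(𝔸_K)` is inversion invariant
  (unimodularity, `GLn.isMulRightInvariant_of_isHaarMeasure_adelic_holds`), the hypothesis of the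
  kernel formula.

Everything is proved; the only definition is the homeomorphism `centerLog`. Measurable structures:
the house local instances `adelicBorel` etc., subgroups with the subtype σ-algebra.

## References

* R. Godement, H. Jacquet, *Zeta functions of simple algebras*, LNM 260 (1972), §12
  [GodementJacquet1972].
* A. Borel, *Some finiteness properties of adele groups over number fields*, Publ. Math. IHÉS 16
  (1963), §5 [Borel1963].
-/

noncomputable section

open MeasureTheory Measure Set Filter Topology IsDedekindDomain NumberField
open Literature.MeasureTheory.Group
open scoped ENNReal NNReal

namespace Literature.NumberTheory.Automorphic

variable (n : ℕ) (K : Type) [Field K] [NumberField K]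

attribute [local instance] adelicBorel borelSpace_adelic locallyCompactSpace_adelic
  secondCountableTopology_gl_adelic

/-! ### `ρ_H = κ · (dα ⊗ counting)` as an identity of measures, and its Bochner form -/

section ProductMeasure

variable {n K}

/-- **Every Haar measure on `H = A_G · GL_n(K)` is `κ · (dα ⊗ counting)` along
`H ≅ A_G × GL_n(K)`** (`quotientSubgroupEquiv`): the measure form of
`exists_lintegral_quotientSubgroup_eq_mul_lintegral_tsum`. [cite: GodementJacquet1972, §12] -/
theorem exists_map_quotientSubgroupEquiv_eq_smul_prod
    (ρ : Measure (AdelicGroupData.gl n K).quotientSubgroup) [ρ.IsHaarMeasure]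
    (α : Measure (AdelicGroupData.gl n K).center') [α.IsHaarMeasure] :
    ∃ κ : ℝ≥0, 0 < κ ∧ ρ.map (quotientSubgroupEquiv n K) =
      κ • α.prod (count : Measure (AdelicGroupData.gl n K).arithmeticSubgroup) := by
  haveI : BorelSpace (AdelicGroupData.gl n K).arithmeticSubgroup := Subtype.borelSpace _
  haveI : (count : Measure (AdelicGroupData.gl n K).arithmeticSubgroup).IsHaarMeasure :=
    isHaarMeasure_count_of_discrete
  haveI : BorelSpace ((AdelicGroupData.gl n K).center' × (AdelicGroupData.gl n K).arithmeticSubgroup) :=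
    Prod.borelSpace
  set e := quotientSubgroupEquiv n K with he
  set π : Measure ((AdelicGroupData.gl n K).center' × (AdelicGroupData.gl n K).arithmeticSubgroup) :=
    α.prod count with hπ
  haveI : π.IsHaarMeasure := by rw [hπ]; infer_instance
  haveI : (ρ.map e).IsHaarMeasure := e.toMulEquiv.isHaarMeasure_map ρ e.continuous e.symm.continuous
  exact ⟨(ρ.map e).haarScalarFactor π, haarScalarFactor_pos_of_isHaarMeasure _ π,
    isMulLeftInvariant_eq_smul _ π⟩

variable {E : Type*} [NormedAddCommGroup E] [NormedSpace ℝ E] [CompleteSpace E]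

/-- **`∫_H F dρ_H = κ ∫_{A_G} Σ_{γ ∈ GL_n(K)} F(a γ) dα(a)` for integrable `F`** (Bochner form of
`exists_lintegral_quotientSubgroup_eq_mul_lintegral_tsum`: transport along `quotientSubgroupEquiv`,
Fubini for `dα ⊗ counting`, and the integral against the counting measure of the countable discrete
group `GL_n(K)` is the sum), together with the absolute convergence: for `α`-a.e. `a` the family
`γ ↦ F(a γ)` is summable in norm, and `a ↦ Σ_γ F(a γ)` is `α`-integrable. This is the shape
`∫_H f(g h) dh = κ Σ_γ ∫_{A_G} f(g a γ) da` of the fibre integrals in the unfolding of the global zeta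
integral (Godement–Jacquet (1972), §12). [cite: GodementJacquet1972, §12 (proof of Thm. 13.8)] -/
theorem integral_quotientSubgroup_eq_smul_integral_tsum
    {ρ : Measure (AdelicGroupData.gl n K).quotientSubgroup} [ρ.IsHaarMeasure]
    {α : Measure (AdelicGroupData.gl n K).center'} [α.IsHaarMeasure] {κ : ℝ≥0}
    (hκ : ρ.map (quotientSubgroupEquiv n K) =
      κ • α.prod (count : Measure (AdelicGroupData.gl n K).arithmeticSubgroup))
    {F : (AdelicGroupData.gl n K).quotientSubgroup → E} (hF : Integrable F ρ) :
    (∀ᵐ a ∂α, Summable fun γ : (AdelicGroupData.gl n K).arithmeticSubgroup =>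
        ‖F ((quotientSubgroupEquiv n K).symm (a, γ))‖) ∧
      Integrable (fun a => ∑' γ : (AdelicGroupData.gl n K).arithmeticSubgroup,
        F ((quotientSubgroupEquiv n K).symm (a, γ))) α ∧
      ∫ h, F h ∂ρ = (κ : ℝ) • ∫ a, ∑' γ : (AdelicGroupData.gl n K).arithmeticSubgroup,
        F ((quotientSubgroupEquiv n K).symm (a, γ)) ∂α := by
  haveI : BorelSpace (AdelicGroupData.gl n K).arithmeticSubgroup := Subtype.borelSpace _
  haveI : BorelSpace ((AdelicGroupData.gl n K).center' × (AdelicGroupData.gl n K).arithmeticSubgroup) :=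
    Prod.borelSpace
  set e := quotientSubgroupEquiv n K with he
  set em : (AdelicGroupData.gl n K).quotientSubgroup ≃ᵐ
      (AdelicGroupData.gl n K).center' × (AdelicGroupData.gl n K).arithmeticSubgroup :=
    e.toHomeomorph.toMeasurableEquiv with hem
  have hem' : (em : _ → _) = e := rfl
  -- `F ∘ e⁻¹` is integrable against `ρ.map e = κ • (α ⊗ count)`
  set F' : (AdelicGroupData.gl n K).center' × (AdelicGroupData.gl n K).arithmeticSubgroup → E :=
    fun p => F (e.symm p) with hF'
  have hcomp : ∀ h, F (e.symm (em h)) = F h := fun h => by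
    rw [hem', ContinuousMulEquiv.symm_apply_apply]
  have hF'ρ : Integrable F' (ρ.map e) := by
    rw [← hem', integrable_map_equiv em]
    have : F' ∘ em = F := funext fun h => hcomp h
    rw [this]
    exact hF
  have hint : ∫ h, F h ∂ρ = ∫ p, F' p ∂(ρ.map e) := by
    rw [← hem', integral_map_equiv em]
    exact integral_congr_ae (Eventually.of_forall fun h => (hcomp h).symm)
  rw [hκ] at hF'ρ
  -- `κ ≠ 0` (`ρ` is a Haar measure)
  have hκ0 : κ ≠ 0 := by
    intro h0
    have h1 : ρ.map e Set.univ = 0 := by rw [hκ, h0, zero_smul]; rfl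
    rw [← hem', em.map_apply, Set.preimage_univ] at h1
    exact (isOpen_univ.measure_pos ρ ⟨1, trivial⟩).ne' h1
  have hF'π : Integrable F' (α.prod count) :=
    (integrable_smul_measure (by exact_mod_cast hκ0) ENNReal.coe_ne_top).1 hF'ρ
  -- Fubini for `α ⊗ count`; the integral against `count` is the sum
  have hprod := (integrable_prod_iff hF'π.1).1 hF'π
  have hcount : ∀ a, Integrable (fun γ : (AdelicGroupData.gl n K).arithmeticSubgroup => F' (a, γ)) count →
      ∫ γ, F' (a, γ) ∂count = ∑' γ, F' (a, γ) := fun a ha => by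
    rw [integral_countable ha]
    refine tsum_congr fun γ => ?_
    rw [measureReal_def, Measure.count_singleton, ENNReal.toReal_one, one_smul]
  have hsum : ∀ᵐ a ∂α, Summable fun γ : (AdelicGroupData.gl n K).arithmeticSubgroup => ‖F' (a, γ)‖ := by
    filter_upwards [hprod.1] with a ha
    exact integrable_count_iff.1 ha
  have hae : (fun a => ∫ γ, F' (a, γ) ∂count) =ᵐ[α]
      fun a => ∑' γ : (AdelicGroupData.gl n K).arithmeticSubgroup, F' (a, γ) := by
    filter_upwards [hprod.1] with a ha
    exact hcount a ha
  refine ⟨hsum, (hF'π.integral_prod_left).congr hae, ?_⟩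
  rw [hint, hκ, integral_smul_nnreal_measure, integral_prod F' hF'π, integral_congr_ae hae]
  rfl

end ProductMeasure

/-! ### The kernel `K_F(x̃, ỹ) = κ ∫_{A_G} Σ_{γ ∈ GL_n(K)} F(x̃ γ a ỹ⁻¹) dα(a)` -/

section Kernel

-- the coset space carries the Borel σ-algebra supplied by the user, not the quotient σ-algebra
attribute [-instance] Quotient.instMeasurableSpace QuotientGroup.measurableSpace

variable {n K}
variable [MeasurableSpace ((AdelicGroupData.gl n K).Adelic ⧸ (AdelicGroupData.gl n K).quotientSubgroup)]
  [BorelSpace ((AdelicGroupData.gl n K).Adelic ⧸ (AdelicGroupData.gl n K).quotientSubgroup)]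
  {𝕜 : Type*} [RCLike 𝕜]

/-- **The kernel of the global zeta integral**: for `x̃, ỹ ∈ GL_n(𝔸_K)` such that
`h ↦ F(x̃ h⁻¹ ỹ⁻¹)` is `ρ_H`-integrable on `H = A_G · GL_n(K)`,
`K_F(x̃, ỹH) = ∫_H F(x̃ h⁻¹ ỹ⁻¹) dρ_H(h) = κ ∫_{A_G} Σ_{γ ∈ GL_n(K)} F(x̃ γ a ỹ⁻¹) dα(a)`
(`ρ_H = κ · dα ⊗ counting`, `integral_quotientSubgroup_eq_smul_integral_tsum`, then `γ ↦ γ⁻¹` and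
`a ↦ a⁻¹`, `α` being inversion invariant on the abelian group `A_G`). This is the kernel
`K(h, g) = Σ_{ξ ∈ G_K} ∫_{A_G} …` of Godement–Jacquet (1972), §12. [cite: GodementJacquet1972, §12] -/
theorem cosetKernel_quotientSubgroup_eq_smul_integral_tsum
    {ρ : Measure (AdelicGroupData.gl n K).quotientSubgroup} [ρ.IsHaarMeasure]
    {α : Measure (AdelicGroupData.gl n K).center'} [α.IsHaarMeasure] [α.IsInvInvariant] {κ : ℝ≥0}
    (hκ : ρ.map (quotientSubgroupEquiv n K) =
      κ • α.prod (count : Measure (AdelicGroupData.gl n K).arithmeticSubgroup))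
    (F : (AdelicGroupData.gl n K).Adelic → 𝕜) (x₀ y₀ : (AdelicGroupData.gl n K).Adelic)
    (hF : Integrable (fun h : (AdelicGroupData.gl n K).quotientSubgroup =>
      F (x₀ * ((h : (AdelicGroupData.gl n K).Adelic))⁻¹ * y₀⁻¹)) ρ) :
    cosetKernel (AdelicGroupData.gl n K).quotientSubgroup ρ F x₀ (QuotientGroup.mk y₀) =
      (κ : ℝ) • ∫ a, ∑' γ : (AdelicGroupData.gl n K).arithmeticSubgroup,
        F (x₀ * (γ : (AdelicGroupData.gl n K).Adelic) * (a : (AdelicGroupData.gl n K).Adelic) * y₀⁻¹) ∂α := by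
  rw [cosetKernel_mk]
  obtain ⟨-, -, h3⟩ := integral_quotientSubgroup_eq_smul_integral_tsum hκ hF
  rw [h3]
  congr 1
  -- `γ ↦ γ⁻¹` inside the sum, then `a ↦ a⁻¹` in the integral
  have hsum : ∀ a : (AdelicGroupData.gl n K).center',
      ∑' γ : (AdelicGroupData.gl n K).arithmeticSubgroup,
          F (x₀ * (((quotientSubgroupEquiv n K).symm (a, γ) : (AdelicGroupData.gl n K).quotientSubgroup) :
            (AdelicGroupData.gl n K).Adelic)⁻¹ * y₀⁻¹) =
        ∑' γ : (AdelicGroupData.gl n K).arithmeticSubgroup,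
          F (x₀ * (γ : (AdelicGroupData.gl n K).Adelic) * ((a : (AdelicGroupData.gl n K).Adelic))⁻¹ * y₀⁻¹) := by
    intro a
    rw [← (Equiv.inv (AdelicGroupData.gl n K).arithmeticSubgroup).tsum_eq]
    refine tsum_congr fun γ => ?_
    simp only [Equiv.inv_apply, coe_quotientSubgroupEquiv_symm_apply, Subgroup.coe_inv, mul_inv_rev,
      inv_inv, mul_assoc]
  simp_rw [hsum]
  rw [← integral_inv_eq_self (μ := α)]
  refine integral_congr_ae (Eventually.of_forall fun a => ?_)
  simp only [Subgroup.coe_inv, inv_inv]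

end Kernel

/-! ### `A_G ≅ ℝ`: the logarithm of `|det|_𝔸` and the Haar measure of `A_G` -/

section CenterLog

variable {n K}

/-- `|det a|_𝔸` is non-zero. [folklore] -/
theorem glAbsDet_coe_ne_zero (g : GL (Fin n) (AdeleRing (𝓞 K) K)) :
    (((glAbsDet n K g : ℝ≥0ˣ) : ℝ≥0) : ℝ) ≠ 0 :=
  NNReal.coe_ne_zero.2 (glAbsDet n K g).ne_zero

/-- `|det|_𝔸` is multiplicative, stated on the carrier `(AdelicGroupData.gl n K).Adelic` (the same
type as `GL_n(𝔸_K)`, for rewriting under the subgroup coercions). [folklore] -/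
theorem glAbsDet_adelic_mul (x y : (AdelicGroupData.gl n K).Adelic) :
    glAbsDet n K ((x * y : (AdelicGroupData.gl n K).Adelic) : GL (Fin n) (AdeleRing (𝓞 K) K)) =
      glAbsDet n K x * glAbsDet n K y :=
  map_mul (glAbsDet n K) x y

variable (n K)

/-- **`A_G ≅ ℝ`, `a ↦ log |det a|_𝔸`** (for `n ≥ 1`): a homeomorphism with inverse
`v ↦ z(e^{v/(n[K:ℚ])})` (`posRealScalar`, `glAbsDet_posRealScalar`), turning multiplication into
addition (`centerLog_mul`). [folklore] -/
def centerLog (hn : 0 < n) : (AdelicGroupData.gl n K).center' ≃ₜ ℝ where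
  toFun a := Real.log (((glAbsDet n K ((a : (AdelicGroupData.gl n K).Adelic) : GL (Fin n) (AdeleRing (𝓞 K) K)) : ℝ≥0ˣ) : ℝ≥0) : ℝ)
  invFun v := ⟨posRealScalar n K (expUnitNNReal (v / (n * Module.finrank ℚ K : ℕ))), ⟨_, rfl⟩⟩
  left_inv a := by
    obtain ⟨_, r, rfl⟩ := a
    refine Subtype.ext ?_
    change posRealScalar n K (expUnitNNReal (Real.log (((glAbsDet n K (posRealScalar n K r) : ℝ≥0ˣ) :
      ℝ≥0) : ℝ) / (n * Module.finrank ℚ K : ℕ))) = posRealScalar n K r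
    have hN : ((n * Module.finrank ℚ K : ℕ) : ℝ) ≠ 0 := by
      exact_mod_cast Nat.mul_ne_zero hn.ne' Module.finrank_pos.ne'
    rw [glAbsDet_posRealScalar, Units.val_pow_eq_pow_val, NNReal.coe_pow, Real.log_pow,
      mul_div_cancel_left₀ _ hN, expUnitNNReal_log]
  right_inv v := by
    change Real.log (((glAbsDet n K (posRealScalar n K (expUnitNNReal (v / (n * Module.finrank ℚ K : ℕ)))) :
      ℝ≥0ˣ) : ℝ≥0) : ℝ) = v
    have hN : ((n * Module.finrank ℚ K : ℕ) : ℝ) ≠ 0 := by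
      exact_mod_cast Nat.mul_ne_zero hn.ne' Module.finrank_pos.ne'
    rw [glAbsDet_posRealScalar, Units.val_pow_eq_pow_val, NNReal.coe_pow, coe_expUnitNNReal,
      ← Real.exp_nat_mul, Real.log_exp, mul_div_cancel₀ _ hN]
  continuous_toFun := by
    refine Continuous.log ?_ fun a => glAbsDet_coe_ne_zero _
    exact (continuous_glAbsDet_real n K).comp continuous_subtype_val
  continuous_invFun :=
    ((continuous_posRealScalar_expUnitNNReal n K).comp (continuous_id.div_const _)).subtype_mk _

variable {n K}

/-- `exp (centerLog a) = |det a|_𝔸`. [folklore] -/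
theorem exp_centerLog (hn : 0 < n) (a : (AdelicGroupData.gl n K).center') :
    Real.exp (centerLog n K hn a) = (((glAbsDet n K ((a : (AdelicGroupData.gl n K).Adelic) : GL (Fin n) (AdeleRing (𝓞 K) K)) : ℝ≥0ˣ) : ℝ≥0) : ℝ) :=
  Real.exp_log (NNReal.coe_pos.2 (pos_iff_ne_zero.2 (glAbsDet n K _).ne_zero))

/-- `centerLog` is a homomorphism to `(ℝ, +)`. [folklore] -/
theorem centerLog_mul (hn : 0 < n) (a b : (AdelicGroupData.gl n K).center') :
    centerLog n K hn (a * b) = centerLog n K hn a + centerLog n K hn b := by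
  change Real.log _ = Real.log _ + Real.log _
  rw [Subgroup.coe_mul, glAbsDet_adelic_mul, Units.val_mul, NNReal.coe_mul,
    Real.log_mul (glAbsDet_coe_ne_zero _) (glAbsDet_coe_ne_zero _)]

/-- **The Haar measure of `A_G` is `c · dv` in the coordinate `v = log |det a|_𝔸`**: for every Haar
measure `α` on `A_G` (`n ≥ 1`) there is `c > 0` with `centerLog_* α = c · (Lebesgue)`. [folklore] -/
theorem exists_map_centerLog_eq_smul_volume (hn : 0 < n)
    (α : Measure (AdelicGroupData.gl n K).center') [α.IsHaarMeasure] :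
    ∃ c : ℝ≥0, 0 < c ∧ α.map (centerLog n K hn) = c • (volume : Measure ℝ) := by
  set L := centerLog n K hn with hL
  set β : Measure ℝ := α.map L with hβ
  have hLm : Measurable L := L.continuous.measurable
  -- `β` is left invariant: translation by `v = L a₀` is conjugate to multiplication by `a₀`
  haveI : β.IsAddLeftInvariant := by
    refine ⟨fun v => ?_⟩
    obtain ⟨a₀, rfl⟩ : ∃ a₀, L a₀ = v := ⟨L.symm v, L.apply_symm_apply v⟩
    rw [hβ, Measure.map_map (measurable_const_add _) hLm]
    have hcomp : ((fun x => L a₀ + x) ∘ L) = L ∘ fun a => a₀ * a := by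
      funext a
      simp only [Function.comp_apply, hL, centerLog_mul]
    rw [hcomp, ← Measure.map_map hLm (measurable_const_mul a₀), map_mul_left_eq_self]
  haveI : IsFiniteMeasureOnCompacts β := by
    refine ⟨fun C hC => ?_⟩
    rw [hβ, Measure.map_apply hLm hC.measurableSet]
    exact ((L.isCompact_preimage).2 hC).measure_lt_top
  -- uniqueness of Haar measure on `ℝ`
  set c : ℝ≥0 := β.addHaarScalarFactor volume with hc
  have hβc : β = c • (volume : Measure ℝ) := isAddLeftInvariant_eq_smul β volume
  refine ⟨c, pos_iff_ne_zero.2 fun h0 => ?_, hβc⟩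
  have h1 : β Set.univ = 0 := by rw [hβc, h0, zero_smul]; rfl
  rw [hβ, Measure.map_apply hLm MeasurableSet.univ, Set.preimage_univ] at h1
  exact (isOpen_univ.measure_pos α ⟨1, trivial⟩).ne' h1

variable {E : Type*} [NormedAddCommGroup E] [NormedSpace ℝ E]

/-- **Integration over `A_G` in the coordinate `v = log |det a|_𝔸`**:
`∫_{A_G} f(log |det a|_𝔸) dα(a) = c ∫_ℝ f(v) dv` (with `c` from
`exists_map_centerLog_eq_smul_volume`; Mellin substitution `|det a|_𝔸 = e^v`). [folklore] -/
theorem integral_comp_centerLog_eq_smul (hn : 0 < n) {α : Measure (AdelicGroupData.gl n K).center'}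
    {c : ℝ≥0} (hα : α.map (centerLog n K hn) = c • (volume : Measure ℝ)) (f : ℝ → E) :
    ∫ a, f (centerLog n K hn a) ∂α = (c : ℝ) • ∫ v, f v := by
  set L := centerLog n K hn with hL
  rw [show (fun a => f (L a)) = fun a => f (L.toMeasurableEquiv a) from by
      funext a; rw [Homeomorph.toMeasurableEquiv_coe],
    ← integral_map_equiv, Homeomorph.toMeasurableEquiv_coe, hα, integral_smul_nnreal_measure,
    NNReal.smul_def]

/-- The `ℝ≥0∞`-valued version: `∫⁻_{A_G} g(log |det a|_𝔸) dα = c ∫⁻_ℝ g dv`. [folklore] -/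
theorem lintegral_comp_centerLog_eq_mul (hn : 0 < n) {α : Measure (AdelicGroupData.gl n K).center'}
    {c : ℝ≥0} (hα : α.map (centerLog n K hn) = c • (volume : Measure ℝ)) (g : ℝ → ℝ≥0∞) :
    ∫⁻ a, g (centerLog n K hn a) ∂α = c * ∫⁻ v, g v := by
  set L := centerLog n K hn with hL
  rw [show (fun a => g (L a)) = fun a => g (L.toMeasurableEquiv a) from by
      funext a; rw [Homeomorph.toMeasurableEquiv_coe],
    ← lintegral_map_equiv, Homeomorph.toMeasurableEquiv_coe, hα, lintegral_smul_measure]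
  rfl

end CenterLog

/-! ### Every Haar measure on `GL_n(𝔸_K)` is inversion invariant -/

section Unimodular

/-- **`GL_n(𝔸_K)` is unimodular**: every Haar measure on it is invariant under `g ↦ g⁻¹` (the tree's
proved fact `GLn.isMulRightInvariant_of_isHaarMeasure_adelic_holds` and
`isInvInvariant_of_isMulRightInvariant` of `GLnIwasawaIntegration`). [folklore] -/
theorem isInvInvariant_of_isHaarMeasure_gl (ν : Measure (AdelicGroupData.gl n K).Adelic) [ν.IsHaarMeasure] :
    ν.IsInvInvariant := by
  haveI : ν.IsMulRightInvariant := GLn.isMulRightInvariant_of_isHaarMeasure_adelic_holds n K ν inferInstance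
  exact isInvInvariant_of_isMulRightInvariant ν

end Unimodular

end Literature.NumberTheory.Automorphic
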